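/-
Copyright (c) 2026. All rights reserved.
Released under Apache 2.0 license as described in the file LICENSE.
-/
import Literature.NumberTheory.GaloisRepresentations.HochschildSerreLowDegree
import Literature.NumberTheory.GaloisRepresentations.FrobeniusQuotientHOne
import Literature.NumberTheory.GaloisRepresentations.InertiaCohomologyFinite
import Literature.NumberTheory.GaloisRepresentations.LocalFieldCdTwo
import Literature.NumberTheory.GaloisRepresentations.LocalGlobalCohomologyFiniteProofs
import Literature.NumberTheory.GaloisRepresentations.PPrimaryDevissage
import HarnessLib

/-!
# The local Euler–Poincaré characteristic of a module of order prime to `p`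

Let `F` be a non-archimedean local field of characteristic `0` with residue characteristic `p`
and let `A` be a finite discrete `Γ_F`-module which is `ℓ`-primary for a prime `ℓ ≠ p`. Then
`χ(Γ_F, A) := #H⁰ · #H² / #H¹ = 1`, i.e.

`#A^{Γ_F} · #H²(F, A) = #H¹(F, A)`.

This is the case "`#A` prime to `p`" of Tate's local Euler–Poincaré characteristic formula
(Milne, *ADT*, I Thm. 2.8; Serre, *Cohomologie galoisienne*, II §5.7 Thm. 5), with the proof of
Harari, *Galois Cohomology and Class Field Theory*, Prop. 10.12 (= Milne I Lemma 2.9,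
Serre II §5.7 Lemma 4): with `I = I_F` the inertia group and `Γ_F / I ≅ Ẑ`,

* `cd_ℓ(I) ≤ 1` and `cd_ℓ(Ẑ) ≤ 1` (`groupCdLE_one_galUnr`, `groupCdLE_one_quotient_galUnr`), so the
  Hochschild–Serre spectral sequence gives `#H²(F, A) = #H¹(Ẑ, H¹(I, A))` and
  `#H¹(F, A) = #H¹(Ẑ, A^I) · #H¹(I, A)^{Ẑ}` (`natCard_two_eq_natCard_one_hOneRep`,
  `natCard_one_eq_mul`);
* `H¹(I, A)` is finite (`natCard_continuousCohomology_one_absInertia_le`);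
* for a finite `Ẑ`-module `T`, `#H¹(Ẑ, T) = #H⁰(Ẑ, T)` (`natCard_continuousCohomology_one_quotient_galUnr`);
* hence `#H²(F, A) = #H¹(I, A)^{Ẑ}` and `#H¹(F, A) = #(A^I)^{Ẑ} · #H¹(I, A)^{Ẑ} = #A^{Γ_F} · #H²(F, A)`.

## Main results

* `natCard_invariants_mul_natCard_two_eq`: `#A^{Γ_F} · #H²(F, A) = #H¹(F, A)` for `ℓ`-primary `A`,
  `ℓ ≠ p`.
* `finite_continuousCohomology_two_of_isPrimaryTorsion`: `H²(F, A)` is finite.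
-/

noncomputable section

open CategoryTheory ContinuousCohomology Function
open Field ValuativeRel
open scoped Valued

universe u

namespace Literature.NumberTheory.GaloisRepresentations

open _root_.TopRep

variable (F : Type u) [Field F] [ValuativeRel F] [TopologicalSpace F] [IsNonarchimedeanLocalField F] [CharZero F]
variable {A : Type u} [AddCommGroup A] [TopologicalSpace A] [DiscreteTopology A] [Finite A]

omit [TopologicalSpace A] [DiscreteTopology A] in
/-- The order of a finite `ℓ`-primary group is prime to every prime `p ≠ ℓ`. [folklore] -/
theorem natCard_coprime_of_isPrimaryTorsion {ℓ : ℕ} [Fact ℓ.Prime] (hA : IsPrimaryTorsion ℓ A) {p : ℕ}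
    (hp : p.Prime) (hℓp : ℓ ≠ p) : (Nat.card A).Coprime p := by
  obtain ⟨m, hm⟩ := exists_card_eq_prime_pow A hA
  rw [hm]
  exact Nat.Coprime.pow_left _ ((Nat.coprime_primes (Fact.out : ℓ.Prime) hp).2 hℓp)

/-- **The local Euler–Poincaré characteristic of an `ℓ`-primary module, `ℓ ≠ p`, is `1`**:
for a non-archimedean local field `F` of characteristic `0` with residue characteristic `p`, a prime
`ℓ ≠ p` and a finite discrete `ℓ`-primary `Γ_F`-module `A`,
`#A^{Γ_F} · #H²(F, A) = #H¹(F, A)`, and `H²(F, A)` is finite.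
[cite: MilneADT2006, I §2 Thm. 2.8 and Lemma 2.9] [cite: SerreGaloisCohomology1997, II §5.7 Thm. 5 and Lemma 4] -/
theorem natCard_invariants_mul_natCard_two_eq (ρ : ContinuousRep (absoluteGaloisGroup F) ℤ A)
    {ℓ : ℕ} [Fact ℓ.Prime] (hA : IsPrimaryTorsion ℓ A) (hℓ : ℓ ≠ ringChar 𝓀[F]) :
    Finite (continuousCohomology 2 ρ.toTopRep) ∧
      Nat.card ρ.toTopRep.ρ.invariants * Nat.card (continuousCohomology 2 ρ.toTopRep) =
        Nat.card (continuousCohomology 1 ρ.toTopRep) := by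
  classical
  haveI := absoluteGaloisGroup_compactSpace F
  haveI : Fact (ringChar 𝓀[F]).Prime := ⟨ringChar_residueField_prime (F := F)⟩
  set N : Subgroup (absoluteGaloisGroup F) := galUnr F
  -- the vanishing inputs from `cd_ℓ(I) ≤ 1` and `cd_ℓ(Γ/I) ≤ 1`
  haveI h2N : Subsingleton (continuousCohomology 2 ((ρ.restrict (subgroupIncl N)).toTopRep)) :=
    groupCdLE_one_galUnr F ℓ A (ρ.restrict (subgroupIncl N)) hA (by norm_num)
  have hAN : IsPrimaryTorsion ℓ (ρ.invariantsOf N) := hA.submodule _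
  haveI h2Q : Subsingleton (continuousCohomology 2 (ρ.quotientInvariants N).toTopRep) :=
    groupCdLE_one_quotient_galUnr F ℓ (ρ.invariantsOf N) (ρ.quotientInvariants N) hAN (by norm_num)
  haveI h3Q : Subsingleton (continuousCohomology 3 (ρ.quotientInvariants N).toTopRep) :=
    groupCdLE_one_quotient_galUnr F ℓ (ρ.invariantsOf N) (ρ.quotientInvariants N) hAN (by norm_num)
  haveI : Finite (continuousCohomology 1 ρ.toTopRep) := finite_galoisCohomology_one_of_isNonarchimedeanLocalField ρ
  -- Hochschild–Serre
  have hs2 := natCard_two_eq_natCard_one_hOneRep N ρ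
  have hs1 := natCard_one_eq_mul N ρ
  -- `H¹(I, A)` is finite
  haveI : Finite (HOne N ρ) := by
    have h := (natCard_continuousCohomology_one_absInertia_le F ρ
      (natCard_coprime_of_isPrimaryTorsion hA (Fact.out : (ringChar 𝓀[F]).Prime) hℓ)).1
    rw [← galUnr_eq_absInertia F] at h
    exact h
  -- `H¹(Ẑ, T) = H⁰(Ẑ, T)` for the finite `Ẑ`-modules `H¹(I, A)` and `A^I`
  have hT := natCard_continuousCohomology_one_quotient_galUnr F (HOne N ρ) (hOneRep N ρ)
  have hAI := natCard_continuousCohomology_one_quotient_galUnr F (ρ.invariantsOf N) (ρ.quotientInvariants N)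
  have h0 : Nat.card (ρ.quotientInvariants N).toTopRep.ρ.invariants = Nat.card ρ.toTopRep.ρ.invariants :=
    Nat.card_congr (invariantsQuotientInvariantsEquiv N ρ)
  rw [hT] at hs2
  rw [hAI, h0] at hs1
  refine ⟨Nat.finite_of_card_ne_zero (hs2 ▸ Nat.card_pos.ne'), ?_⟩
  rw [hs1, hs2]

/-- `H²(F, A)` is finite for a finite `ℓ`-primary `A`, `ℓ ≠ p`. [cite: MilneADT2006, I §2 Thm. 2.8] -/
theorem finite_continuousCohomology_two_of_isPrimaryTorsion (ρ : ContinuousRep (absoluteGaloisGroup F) ℤ A)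
    {ℓ : ℕ} [Fact ℓ.Prime] (hA : IsPrimaryTorsion ℓ A) (hℓ : ℓ ≠ ringChar 𝓀[F]) :
    Finite (continuousCohomology 2 ρ.toTopRep) :=
  (natCard_invariants_mul_natCard_two_eq F ρ hA hℓ).1

end Literature.NumberTheory.GaloisRepresentations

end
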